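/-
Copyright (c) 2026. All rights reserved.
Released under Apache 2.0 license as described in the file LICENSE.
Authors: abc-iut cell, F lane seat abc-iut-f-073 (gen 6; KEY INST59H2), over abc-iut-L4-t3's statement
(`LogFrobeniusCorollaries.lean`), abc-iut-L4-t15's discharge (`LogFrobeniusTelecoreProofs.lean`) and the genuine
carriers of abc-iut-f-101 (`LogFrobeniusMonoTelecoreGenuineOpen.lean`) and abc-iut-w4-d095
(`LogFrobeniusLogWallArchOrigin.lean`, over abc-iut-L4-t10 / abc-iut-w5-d226's `HolRS.geometricAutHolFieldFunctor`);
everything consumed BY NAME.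
-/
import Literature.AnabelianGeometry.AbsoluteAnabelian.LogFrobeniusTelecoreProofs
import Literature.AnabelianGeometry.AbsoluteAnabelian.LogFrobeniusMonoTelecoreGenuineOpen
import Literature.AnabelianGeometry.AbsoluteAnabelian.LogFrobeniusLogWallArchOrigin
import Literature.AnabelianGeometry.AbsoluteAnabelian.ArchimedeanHolFieldFunctorGeometric
import HarnessLib

/-!
# FACT-LIST row F-0143 `LogFrobeniusSetting.Cor55Telecore` ([AbsTopIII] Cor 5.5 (ii)) — INSTANCE FORMS at the
# genuine carriers of the tree

S. Mochizuki, *Topics in Absolute Anabelian Geometry III*, J. Math. Sci. Univ. Tokyo 22 (2015) [MochizukiAbsTopIII2015],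
Corollary 5.5 (ii), kurims manuscript pp. 130–131 (`paper:url-5493eb38cbb7`): «The "forgetful functor" `φ_{An•}` gives
rise to a telecore structure `𝔗_{An•}` on `D•_{≤5}` … the collection of natural transformations
`{η_{□⋎}, η_{□⋎}⁻¹, η_⋏, η_⋏⁻¹}` … generate a contact structure `ℋ_{An•}` on the telecore `𝔗_{An•}`»; typed by
abc-iut-L4-t3 as the schema `LogFrobeniusSetting.Cor55Telecore L` over an ABSTRACT global log-Frobenius setting
`L : LogFrobeniusSetting Vmod isArc`.

PROOF-ONLY companion (no `def`, nothing restated).  Kernel status before this file: the universal closer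
`cor55Telecore_holds` (every setting with `V(F_mod) ≠ ∅`, abc-iut-L4-t15), the degenerate-corner refuter
`not_cor55Telecore_of_isEmpty` and `cor55Telecore_iff_nonempty` — no theorem whose conclusion head is the row AT A NAMED
CARRIER.  This file records those INSTANCE FORMS, at the two GENUINE setting producers the tree holds:

* `cor55Telecore_genuineOpen` / `cor55Telecore_genuineOpen_two` — at abc-iut-f-101's genuine nonarchimedean
  open-augmentation setting `genuineOpen p Vmod` (`𝒳 = 𝒳^{open}` over the MLF model `𝒞^{MLF-sB}_{TF}` on `ℚ̄_p`, genuine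
  perfected mono-analytic rows; all places nonarchimedean), for every prime `p` and every nonempty index set, and with
  ZERO binders at `p = 2`, `V(F_mod) = {pt}`;
* `cor55Telecore_archGenuine_geometric` / `cor55Telecore_archGenuine_geometric_pt` — at abc-iut-w4-d095's setting with
  GENUINE ARCHIMEDEAN components `archGenuine 𝔄 Vmod isArc` over the holomorphic GEOMETRIC Aut-holomorphic field functor
  `HolRS.geometricAutHolFieldFunctor Q` (connected Riemann surfaces cut out by `Q`, `𝒜 := ℂ`), for every `Q`, index set
  and `isArc`, and with ZERO binders at `Q = ⊤`, one archimedean place.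

Each is a specialisation of `cor55Telecore_holds`; the carriers' own honest labels apply (the nonarchimedean
components of `archGenuine` and its mono-analytic side are placeholders; `genuineOpen` has no archimedean place).
HONEST FRAMING: refereed pre-IUT material; an instance-form theorem about OUR typed statement at OUR carriers, not a
theorem about IUT in print; nothing here bears on [IUTchIII] Cor. 3.12; no side taken; typed ≠ proved.
-/

set_option autoImplicit false

universe u

open CategoryTheory

namespace Literature.AnabelianGeometry.AbsoluteAnabelian

namespace LogFrobeniusSetting

/-! ## At the genuine nonarchimedean open-augmentation setting `genuineOpen p` -/

/-- **F-0143, INSTANCE FORM at `genuineOpen p Vmod`** (abc-iut-f-101's genuine nonarchimedean setting; binders: a prime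
`p` and a nonempty index set `V(F_mod)`, both inhabited types; no further hypothesis): the forgetful functor `φ_{An•}`
gives a telecore `𝔗_{An•}` with a contact structure — [AbsTopIII] Cor 5.5 (ii) pp. 130–131 as typed, by
`cor55Telecore_holds`. [cite: MochizukiAbsTopIII2015, Cor 5.5 (ii) p.130] -/
theorem cor55Telecore_genuineOpen (p : ℕ) [Fact p.Prime] (Vmod : Type 1) [Nonempty Vmod] :
    Literature.AnabelianGeometry.AbsoluteAnabelian.LogFrobeniusSetting.Cor55Telecore (genuineOpen p Vmod) :=
  (genuineOpen p Vmod).cor55Telecore_holds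

/-- **F-0143, ZERO-BINDER INSTANCE at `genuineOpen 2 {pt}`**: the typed Cor 5.5 (ii) at the genuine `2`-adic
open-augmentation setting with one (nonarchimedean) place. [cite: MochizukiAbsTopIII2015, Cor 5.5 (ii) p.130] -/
theorem cor55Telecore_genuineOpen_two :
    Literature.AnabelianGeometry.AbsoluteAnabelian.LogFrobeniusSetting.Cor55Telecore
      (genuineOpen 2 PUnit.{2}) :=
  haveI : Fact (Nat.Prime 2) := ⟨Nat.prime_two⟩
  (genuineOpen 2 PUnit.{2}).cor55Telecore_holds

/-! ## At the setting with genuine archimedean components over the geometric Aut-holomorphic field functor -/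

/-- **F-0143, INSTANCE FORM at `archGenuine (HolRS.geometricAutHolFieldFunctor Q) Vmod isArc`** (abc-iut-w4-d095's
setting with print's archimedean arrows `k~ →(id) k~ ↠(exp) k^× ↪ k` over the holomorphic geometric model of
connected Riemann surfaces; binders: the object property `Q`, a nonempty index set, the archimedean flag; no further
hypothesis): [AbsTopIII] Cor 5.5 (ii) pp. 130–131 as typed. [cite: MochizukiAbsTopIII2015, Cor 5.5 (ii) p.130] -/
theorem cor55Telecore_archGenuine_geometric (Q : ObjectProperty HolRS) (Vmod : Type 1) [Nonempty Vmod]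
    (isArc : Vmod → Bool) :
    Literature.AnabelianGeometry.AbsoluteAnabelian.LogFrobeniusSetting.Cor55Telecore
      (archGenuine (HolRS.geometricAutHolFieldFunctor Q) Vmod isArc) :=
  (archGenuine (HolRS.geometricAutHolFieldFunctor Q) Vmod isArc).cor55Telecore_holds

/-- **F-0143, ZERO-BINDER INSTANCE at the geometric archimedean setting with ONE archimedean place** (`Q = ⊤`: all
connected Riemann surfaces; `V(F_mod) = {pt}`, `isArc ≡ true`). [cite: MochizukiAbsTopIII2015, Cor 5.5 (ii) p.130] -/
theorem cor55Telecore_archGenuine_geometric_pt :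
    Literature.AnabelianGeometry.AbsoluteAnabelian.LogFrobeniusSetting.Cor55Telecore
      (archGenuine (HolRS.geometricAutHolFieldFunctor ⊤) PUnit.{2} (fun _ => true)) :=
  (archGenuine (HolRS.geometricAutHolFieldFunctor ⊤) PUnit.{2} (fun _ => true)).cor55Telecore_holds

end LogFrobeniusSetting

end Literature.AnabelianGeometry.AbsoluteAnabelian
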